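import Summits.QuantumFields.BalabanUV.Beta.GAN24.BiStencilZeroMode

/-!
# `BalabanUV.Beta.GAN24.TransversalZeroMode` — binder row G-an2-4 / (CONV-C), W-slot road «W3» (SKELETON-W3 v1.0.2 §8.3/§8.5):
# THE POINTWISE (TRANSVERSAL) FORM OF THE ff ZERO MODE — for tables covariant under ALL unit translations of their own
# lattice the inner sum `u ↦ Σ'_{u′} Σ'_x Σ'_z X κ u κ′ u′ x z a b` is CONSTANT, so `zmode N X = N^{d+1} · (inner sum at 0)` and
# «`zmode N X = 0`» ⇔ «the inner sum vanishes AT EVERY FIRST BOND `u`»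

NOT IN PRINT; OUR BOOKKEEPING (G-an2-4 formalisation swarm, leaf prover `b2b-balaban-gan24-formalise-leaf-16`, gen 12; journal NOTE
«ZFREE-POINTWISE» + INTENT «W3-ZPT*»; module name PROVISIONAL — the row owner gan24-p1 may rename / re-home it).
HONEST FRAMING (cell contract, verbatim): «discharging `BetaPertH` makes Bałaban's UV stability UNCONDITIONAL — a real constructive-QFT result;
it is NOT the continuum limit and NOT the Clay problem.»  HONEST DEPENDENCY (verbatim): «continuum YM on T⁴ ⇐ BetaPertH ∧ nine spine estimates
(0/9 proved); BetaPertH ⇐ (D1) ∧ (D4) ∧ CAP+tail; G-an2-4 gates asym, D1 and NE2/3/4.»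

WHY.  The transport row `hTirr` of the W3 ENDs (`WSlotT2OfPieces.shape_of_rows` / `rate_of_rows`, p211117) quantifies over ALL `LocStencil₂`
tables `X` with `Zfree X`.  Instantiating `Zfree X` by leaf-02's cell zero mode `BiStencilZeroMode.zmode Lc X … = 0` ALONE constrains the first
bond only on the origin cell `box (d+1) Lc` and makes the ∀-`X` row false for non-covariant `X` (journal NOTE «ZFREE-POINTWISE»); the
POINTWISE transversal form
  `∀ κ u κ′ α β, ∑' u′, ∑' x, ∑' z, X κ u κ′ u′ x z (Sum.inl α) (Sum.inl β) = 0`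
is the hypothesis under which one Taylor order against the block-smooth composite legs gains `L⁻¹` with NO block-oscillation step.  THIS module
is the bridge showing the pointwise form costs the zero-mode provers nothing: the value parts of every table of the tower are covariant under ALL
unit translations of their own lattice (an2's `BalabanStepW2.e4OfW_translate`, an3's `wilsonW₂_translate`), and for such tables the two forms
are EQUIVALENT (§2–§3); the converse direction (§3 `zmode_eq_zero_of_inner_eq_zero`) needs no covariance at all.

WHAT ([folklore] re-indexing of absolutely-or-not convergent nested `tsum`s — every identity below holds WITHOUT summability, exactly as
leaf-02's `inner_periodic`; generic `d`, generic period `N`):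
* §1 `Translate X` — NOT a definition: the hypothesis shape `∀ κ u κ′ u′ t, X κ (u + t) κ′ (u′ + t) = shiftK (−t) (X κ u κ′ u′)` (joint
  covariance under all unit translations; `e4OfW_translate`'s conclusion shape) is written inline everywhere;
  `inner_eq_inner_zero` : covariant ⇒ `∀ u, Σ'_{u′xz} X κ u κ′ u′ x z a b = Σ'_{u′xz} X κ 0 κ′ u′ x z a b`.
* §2 `zmode_eq_pow_mul_inner` : covariant ⇒ `zmode N X κ κ′ a b = (N:ℝ)^(d+1) · Σ'_{u′xz} X κ 0 κ′ u′ x z a b`.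
* §3 `inner_eq_zero_of_zmode_eq_zero` : covariant ∧ `zmode N X κ κ′ a b = 0` ∧ `N ≠ 0` ⇒ `∀ u, Σ'_{u′xz} X κ u κ′ u′ x z a b = 0`;
  `zmode_eq_zero_of_inner_eq_zero` : (∀ u, inner sum = 0) ⇒ `zmode N X κ κ′ a b = 0` (no covariance);
  `zmode_eq_zero_iff_inner_eq_zero` (covariant, `N ≠ 0`).
* §4 covariance bookkeeping for the takers of rows W3-F2a/F2b/F4d: `translate_smul`, `translate_add`, `translate_sub`, `translate_fibreScale`
  (entrywise fibre re-weightings such as `SecondOrderUnits.unitS₂` preserve covariance), and the pointwise zero mode is likewise closed under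
  these operations: `inner_smul`, `inner_add_eq` / `inner_sub_eq` (under summability of the two slices), `inner_fibreScale`.
0 `def`, 0 cite, 0 `def … : Prop`, 0 sorry; asserts NO shape of Bałaban's tables; NOT a row of SKELETON-W3; discharges NOTHING of (hW, hWall);
NOT «W-slot closed», NEVER «G-an2-4 closed»; NOT BetaPertH, NOT continuum, NOT Clay.
-/

noncomputable section

open Finset
open scoped BigOperators
open Literature.MathematicalPhysics.QuantumFieldTheory
open Literature.MathematicalPhysics.QuantumFieldTheory.Balaban1983to89
open Literature.MathematicalPhysics.QuantumFieldTheory.Balaban1983to89.Beta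
open ExpKernelCalculus (MKer shiftK)
open OneStepResolventKernel (Fib)
open AffineAveraging (box toSite)
open Summit.QuantumFields.BalabanUV.Beta.GAN24.BiStencilZeroMode (Tab zmode inner_periodic)

namespace Summit.QuantumFields.BalabanUV.Beta.GAN24.TransversalZeroMode

variable {d : ℕ}

/-! ## §1 Covariance under all unit translations makes the transversal inner sum constant -/

/-- [folklore] **THE INNER SUM OF A 1-COVARIANT TABLE IS CONSTANT IN THE FIRST BOND.**  If `X κ (u + t) κ′ (u′ + t) = shiftK (−t) (X κ u κ′ u′)`
for every unit translation `t` (the conclusion shape of an2's `e4OfW_translate`), then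
`Σ'_{u′} Σ'_x Σ'_z X κ u κ′ u′ x z a b = Σ'_{u′} Σ'_x Σ'_z X κ 0 κ′ u′ x z a b` for every `u` (leaf-02's `inner_periodic` at period `1`;
no summability needed). -/
theorem inner_eq_inner_zero {X : Tab d}
    (hX : ∀ (κ : Fin (d + 1)) (u : Fin (d + 1) → ℤ) (κ' : Fin (d + 1)) (u' t : Fin (d + 1) → ℤ),
      X κ (u + t) κ' (u' + t) = shiftK (-t) (X κ u κ' u'))
    (κ κ' : Fin (d + 1)) (a b : Fib d) (u : Fin (d + 1) → ℤ) :
    (∑' u', ∑' x, ∑' z, X κ u κ' u' x z a b) = ∑' u', ∑' x, ∑' z, X κ 0 κ' u' x z a b := by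
  have hX1 : ∀ (κ : Fin (d + 1)) (u : Fin (d + 1) → ℤ) (κ' : Fin (d + 1)) (u' t : Fin (d + 1) → ℤ),
      X κ (u + ((1 : ℕ) : ℤ) • t) κ' (u' + ((1 : ℕ) : ℤ) • t) = shiftK (-(((1 : ℕ) : ℤ) • t)) (X κ u κ' u') := by
    intro κ u κ' u' t
    simpa only [Nat.cast_one, one_smul] using hX κ u κ' u' t
  have h := inner_periodic (N := 1) (T := X) hX1 κ κ' a b 0 u
  simpa only [Nat.cast_one, one_smul, zero_add] using h

/-! ## §2 The cell zero mode of a 1-covariant table is `N^{d+1}` times the inner sum -/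

/-- [folklore] `#box (d+1) N = N^{d+1}` (as computed inline in an2's `AffineAveraging`). -/
theorem card_box_succ (N : ℕ) : (box (d + 1) N).card = N ^ (d + 1) := by
  simp [AffineAveraging.box, Fintype.card_piFinset]

/-- [folklore] **`zmode N X = N^{d+1} · (inner sum at the origin)` FOR A 1-COVARIANT TABLE** — the `N^{d+1}` first bonds of the cell all carry
the same inner sum. -/
theorem zmode_eq_pow_mul_inner {N : ℕ} {X : Tab d}
    (hX : ∀ (κ : Fin (d + 1)) (u : Fin (d + 1) → ℤ) (κ' : Fin (d + 1)) (u' t : Fin (d + 1) → ℤ),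
      X κ (u + t) κ' (u' + t) = shiftK (-t) (X κ u κ' u'))
    (κ κ' : Fin (d + 1)) (a b : Fib d) :
    zmode N X κ κ' a b = ((N : ℝ)) ^ (d + 1) * ∑' u', ∑' x, ∑' z, X κ 0 κ' u' x z a b := by
  unfold zmode
  rw [Finset.sum_congr rfl fun r _ => inner_eq_inner_zero hX κ κ' a b (toSite r), Finset.sum_const, card_box_succ, nsmul_eq_mul]
  push_cast
  ring

/-! ## §3 The two forms of the zero mode -/

/-- [folklore] **CELL ZERO MODE ⇒ POINTWISE ZERO MODE** for a 1-covariant table and a genuine period `N ≠ 0`. -/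
theorem inner_eq_zero_of_zmode_eq_zero {N : ℕ} (hN : N ≠ 0) {X : Tab d}
    (hX : ∀ (κ : Fin (d + 1)) (u : Fin (d + 1) → ℤ) (κ' : Fin (d + 1)) (u' t : Fin (d + 1) → ℤ),
      X κ (u + t) κ' (u' + t) = shiftK (-t) (X κ u κ' u'))
    {κ κ' : Fin (d + 1)} {a b : Fib d} (hZ : zmode N X κ κ' a b = 0) (u : Fin (d + 1) → ℤ) :
    (∑' u', ∑' x, ∑' z, X κ u κ' u' x z a b) = 0 := by
  rw [inner_eq_inner_zero hX κ κ' a b u]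
  rw [zmode_eq_pow_mul_inner hX κ κ' a b] at hZ
  have hpow : ((N : ℝ)) ^ (d + 1) ≠ 0 := pow_ne_zero _ (Nat.cast_ne_zero.mpr hN)
  rcases mul_eq_zero.mp hZ with h | h
  · exact absurd h hpow
  · exact h

/-- [folklore] **POINTWISE ZERO MODE ⇒ CELL ZERO MODE** (no covariance needed: every term of the cell sum vanishes). -/
theorem zmode_eq_zero_of_inner_eq_zero (N : ℕ) {X : Tab d} {κ κ' : Fin (d + 1)} {a b : Fib d}
    (hI : ∀ u : Fin (d + 1) → ℤ, (∑' u', ∑' x, ∑' z, X κ u κ' u' x z a b) = 0) :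
    zmode N X κ κ' a b = 0 := by
  unfold zmode
  exact Finset.sum_eq_zero fun r _ => hI (toSite r)

/-- [folklore] **THE TWO FORMS ARE EQUIVALENT** for a 1-covariant table and `N ≠ 0`. -/
theorem zmode_eq_zero_iff_inner_eq_zero {N : ℕ} (hN : N ≠ 0) {X : Tab d}
    (hX : ∀ (κ : Fin (d + 1)) (u : Fin (d + 1) → ℤ) (κ' : Fin (d + 1)) (u' t : Fin (d + 1) → ℤ),
      X κ (u + t) κ' (u' + t) = shiftK (-t) (X κ u κ' u'))
    (κ κ' : Fin (d + 1)) (a b : Fib d) :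
    zmode N X κ κ' a b = 0 ↔ ∀ u : Fin (d + 1) → ℤ, (∑' u', ∑' x, ∑' z, X κ u κ' u' x z a b) = 0 :=
  ⟨fun hZ u => inner_eq_zero_of_zmode_eq_zero hN hX hZ u, fun hI => zmode_eq_zero_of_inner_eq_zero N hI⟩

/-- [folklore] The ff instance used by the W3 rows ((R14-6): field–field kernel slots): for a 1-covariant table, leaf-02's
`∀ κ κ′ α β, zmode N X κ κ′ (inl α) (inl β) = 0` is equivalent to the pointwise transversal form
`∀ κ u κ′ α β, Σ'_{u′xz} X κ u κ′ u′ x z (inl α) (inl β) = 0`. -/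
theorem zmode_ff_eq_zero_iff_pointwise {N : ℕ} (hN : N ≠ 0) {X : Tab d}
    (hX : ∀ (κ : Fin (d + 1)) (u : Fin (d + 1) → ℤ) (κ' : Fin (d + 1)) (u' t : Fin (d + 1) → ℤ),
      X κ (u + t) κ' (u' + t) = shiftK (-t) (X κ u κ' u')) :
    (∀ (κ κ' α β : Fin (d + 1)), zmode N X κ κ' (Sum.inl α) (Sum.inl β) = 0) ↔
      ∀ (κ : Fin (d + 1)) (u : Fin (d + 1) → ℤ) (κ' α β : Fin (d + 1)),
        (∑' u', ∑' x, ∑' z, X κ u κ' u' x z (Sum.inl α) (Sum.inl β)) = 0 :=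
  ⟨fun h κ u κ' α β => inner_eq_zero_of_zmode_eq_zero hN hX (h κ κ' α β) u,
    fun h κ κ' α β => zmode_eq_zero_of_inner_eq_zero N fun u => h κ u κ' α β⟩

/-! ## §4 Bookkeeping: covariance and the pointwise zero mode under the operations the row takers meet -/

section Bookkeeping

variable {X Y : Tab d}

/-- [folklore] Scalar multiples of a 1-covariant table are 1-covariant. -/
theorem translate_smul (c : ℝ)
    (hX : ∀ (κ : Fin (d + 1)) (u : Fin (d + 1) → ℤ) (κ' : Fin (d + 1)) (u' t : Fin (d + 1) → ℤ),
      X κ (u + t) κ' (u' + t) = shiftK (-t) (X κ u κ' u'))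
    (κ : Fin (d + 1)) (u : Fin (d + 1) → ℤ) (κ' : Fin (d + 1)) (u' t : Fin (d + 1) → ℤ) :
    (c • X) κ (u + t) κ' (u' + t) = shiftK (-t) ((c • X) κ u κ' u') := by
  funext x z a b
  simp only [Pi.smul_apply, smul_eq_mul, shiftK, hX κ u κ' u' t]

/-- [folklore] Sums of 1-covariant tables are 1-covariant. -/
theorem translate_add
    (hX : ∀ (κ : Fin (d + 1)) (u : Fin (d + 1) → ℤ) (κ' : Fin (d + 1)) (u' t : Fin (d + 1) → ℤ),
      X κ (u + t) κ' (u' + t) = shiftK (-t) (X κ u κ' u'))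
    (hY : ∀ (κ : Fin (d + 1)) (u : Fin (d + 1) → ℤ) (κ' : Fin (d + 1)) (u' t : Fin (d + 1) → ℤ),
      Y κ (u + t) κ' (u' + t) = shiftK (-t) (Y κ u κ' u'))
    (κ : Fin (d + 1)) (u : Fin (d + 1) → ℤ) (κ' : Fin (d + 1)) (u' t : Fin (d + 1) → ℤ) :
    (X + Y) κ (u + t) κ' (u' + t) = shiftK (-t) ((X + Y) κ u κ' u') := by
  funext x z a b
  simp only [Pi.add_apply, shiftK, hX κ u κ' u' t, hY κ u κ' u' t]

/-- [folklore] Differences of 1-covariant tables are 1-covariant (the first difference `T♮_1 − T♮_0` of row W3-F4d). -/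
theorem translate_sub
    (hX : ∀ (κ : Fin (d + 1)) (u : Fin (d + 1) → ℤ) (κ' : Fin (d + 1)) (u' t : Fin (d + 1) → ℤ),
      X κ (u + t) κ' (u' + t) = shiftK (-t) (X κ u κ' u'))
    (hY : ∀ (κ : Fin (d + 1)) (u : Fin (d + 1) → ℤ) (κ' : Fin (d + 1)) (u' t : Fin (d + 1) → ℤ),
      Y κ (u + t) κ' (u' + t) = shiftK (-t) (Y κ u κ' u'))
    (κ : Fin (d + 1)) (u : Fin (d + 1) → ℤ) (κ' : Fin (d + 1)) (u' t : Fin (d + 1) → ℤ) :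
    (X - Y) κ (u + t) κ' (u' + t) = shiftK (-t) ((X - Y) κ u κ' u') := by
  funext x z a b
  simp only [Pi.sub_apply, shiftK, hX κ u κ' u' t, hY κ u κ' u' t]

/-- [folklore] **ENTRYWISE FIBRE RE-WEIGHTINGS PRESERVE COVARIANCE**: if `Y κ u κ′ u′ x z a b = w a b · X κ u κ′ u′ x z a b` with a weight
depending on the fibre indices only (an2's changes of units `unitS₂ s_f s_m`, `unitW`, … are of this form), then `Y` is 1-covariant when `X` is. -/
theorem translate_fibreScale (w : Fib d → Fib d → ℝ)
    (hY : ∀ κ u κ' u' x z a b, Y κ u κ' u' x z a b = w a b * X κ u κ' u' x z a b)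
    (hX : ∀ (κ : Fin (d + 1)) (u : Fin (d + 1) → ℤ) (κ' : Fin (d + 1)) (u' t : Fin (d + 1) → ℤ),
      X κ (u + t) κ' (u' + t) = shiftK (-t) (X κ u κ' u'))
    (κ : Fin (d + 1)) (u : Fin (d + 1) → ℤ) (κ' : Fin (d + 1)) (u' t : Fin (d + 1) → ℤ) :
    Y κ (u + t) κ' (u' + t) = shiftK (-t) (Y κ u κ' u') := by
  funext x z a b
  rw [hY, hX κ u κ' u' t]
  simp only [shiftK, hY]

/-- [folklore] The pointwise zero mode is homogeneous: inner sums of `c • X` are `c ·` those of `X` (no summability needed). -/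
theorem inner_smul (c : ℝ) (κ : Fin (d + 1)) (u : Fin (d + 1) → ℤ) (κ' : Fin (d + 1)) (a b : Fib d) :
    (∑' u', ∑' x, ∑' z, (c • X) κ u κ' u' x z a b) = c * ∑' u', ∑' x, ∑' z, X κ u κ' u' x z a b := by
  simp only [Pi.smul_apply, smul_eq_mul]
  rw [← tsum_mul_left]
  refine tsum_congr fun u' => ?_
  rw [← tsum_mul_left]
  refine tsum_congr fun x => ?_
  rw [← tsum_mul_left]

/-- [folklore] Inner sums of an entrywise fibre re-weighting are the re-weighted inner sums (the weight does not see positions). -/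
theorem inner_fibreScale (w : Fib d → Fib d → ℝ)
    (hY : ∀ κ u κ' u' x z a b, Y κ u κ' u' x z a b = w a b * X κ u κ' u' x z a b)
    (κ : Fin (d + 1)) (u : Fin (d + 1) → ℤ) (κ' : Fin (d + 1)) (a b : Fib d) :
    (∑' u', ∑' x, ∑' z, Y κ u κ' u' x z a b) = w a b * ∑' u', ∑' x, ∑' z, X κ u κ' u' x z a b := by
  rw [← tsum_mul_left]
  refine tsum_congr fun u' => ?_
  rw [← tsum_mul_left]
  refine tsum_congr fun x => ?_
  rw [← tsum_mul_left]
  exact tsum_congr fun z => hY κ u κ' u' x z a b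

/-- [folklore] In particular an entrywise fibre re-weighting of a pointwise zero-mode-free table is pointwise zero-mode-free
(the normalised table `unitS₂ … (T2Of … j)` versus the raw one). -/
theorem inner_fibreScale_eq_zero (w : Fib d → Fib d → ℝ)
    (hY : ∀ κ u κ' u' x z a b, Y κ u κ' u' x z a b = w a b * X κ u κ' u' x z a b)
    {κ : Fin (d + 1)} {u : Fin (d + 1) → ℤ} {κ' : Fin (d + 1)} {a b : Fib d}
    (hI : (∑' u', ∑' x, ∑' z, X κ u κ' u' x z a b) = 0) :
    (∑' u', ∑' x, ∑' z, Y κ u κ' u' x z a b) = 0 := by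
  rw [inner_fibreScale w hY, hI, mul_zero]

/-- [folklore] Inner sums are additive on slices that are summable AS TRIPLE FAMILIES (the `LocStencil₂` tables of the tower are:
their slices carry the summable majorant `C e^{−δ|u′−u|} e^{−δ(|x−u|+|z−u|)}`); stated with the three nested summabilities as hypotheses
so that no decay currency is imported here. -/
theorem inner_add_eq (κ : Fin (d + 1)) (u : Fin (d + 1) → ℤ) (κ' : Fin (d + 1)) (a b : Fib d)
    (hXz : ∀ u' x, Summable fun z => X κ u κ' u' x z a b) (hYz : ∀ u' x, Summable fun z => Y κ u κ' u' x z a b)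
    (hXx : ∀ u', Summable fun x => ∑' z, X κ u κ' u' x z a b) (hYx : ∀ u', Summable fun x => ∑' z, Y κ u κ' u' x z a b)
    (hXu : Summable fun u' => ∑' x, ∑' z, X κ u κ' u' x z a b) (hYu : Summable fun u' => ∑' x, ∑' z, Y κ u κ' u' x z a b) :
    (∑' u', ∑' x, ∑' z, (X + Y) κ u κ' u' x z a b)
      = (∑' u', ∑' x, ∑' z, X κ u κ' u' x z a b) + ∑' u', ∑' x, ∑' z, Y κ u κ' u' x z a b := by
  rw [← hXu.tsum_add hYu]
  refine tsum_congr fun u' => ?_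
  rw [← (hXx u').tsum_add (hYx u')]
  refine tsum_congr fun x => ?_
  rw [← (hXz u' x).tsum_add (hYz u' x)]
  rfl

/-- [folklore] Inner sums are subtractive on summable slices (the first difference of row W3-F4d, the forcing of row W3-F2b). -/
theorem inner_sub_eq (κ : Fin (d + 1)) (u : Fin (d + 1) → ℤ) (κ' : Fin (d + 1)) (a b : Fib d)
    (hXz : ∀ u' x, Summable fun z => X κ u κ' u' x z a b) (hYz : ∀ u' x, Summable fun z => Y κ u κ' u' x z a b)
    (hXx : ∀ u', Summable fun x => ∑' z, X κ u κ' u' x z a b) (hYx : ∀ u', Summable fun x => ∑' z, Y κ u κ' u' x z a b)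
    (hXu : Summable fun u' => ∑' x, ∑' z, X κ u κ' u' x z a b) (hYu : Summable fun u' => ∑' x, ∑' z, Y κ u κ' u' x z a b) :
    (∑' u', ∑' x, ∑' z, (X - Y) κ u κ' u' x z a b)
      = (∑' u', ∑' x, ∑' z, X κ u κ' u' x z a b) - ∑' u', ∑' x, ∑' z, Y κ u κ' u' x z a b := by
  rw [← hXu.tsum_sub hYu]
  refine tsum_congr fun u' => ?_
  rw [← (hXx u').tsum_sub (hYx u')]
  refine tsum_congr fun x => ?_
  rw [← (hXz u' x).tsum_sub (hYz u' x)]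
  rfl

/-- [folklore] Hence sums and differences of pointwise zero-mode-free tables with summable slices are pointwise zero-mode-free. -/
theorem inner_sub_eq_zero (κ : Fin (d + 1)) (u : Fin (d + 1) → ℤ) (κ' : Fin (d + 1)) (a b : Fib d)
    (hXz : ∀ u' x, Summable fun z => X κ u κ' u' x z a b) (hYz : ∀ u' x, Summable fun z => Y κ u κ' u' x z a b)
    (hXx : ∀ u', Summable fun x => ∑' z, X κ u κ' u' x z a b) (hYx : ∀ u', Summable fun x => ∑' z, Y κ u κ' u' x z a b)
    (hXu : Summable fun u' => ∑' x, ∑' z, X κ u κ' u' x z a b) (hYu : Summable fun u' => ∑' x, ∑' z, Y κ u κ' u' x z a b)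
    (hIX : (∑' u', ∑' x, ∑' z, X κ u κ' u' x z a b) = 0) (hIY : (∑' u', ∑' x, ∑' z, Y κ u κ' u' x z a b) = 0) :
    (∑' u', ∑' x, ∑' z, (X - Y) κ u κ' u' x z a b) = 0 := by
  rw [inner_sub_eq κ u κ' a b hXz hYz hXx hYx hXu hYu, hIX, hIY, sub_zero]

end Bookkeeping

end Summit.QuantumFields.BalabanUV.Beta.GAN24.TransversalZeroMode

end
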